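import Summits.CriticalPhenomena.PercolationContinuityZ3.Theses.PercExchangeRateTransport

/-!
# Sketch — crux-ideate round 1 (ideator 2) for `SubcritExchangeUniformity` (stmt-CriticalPhenomena-16062)

First lemmas of two crux ideas, typed over the local names of `Lines/onesided.lean`
(`ThetaBox n p t = Θ_n(p,t)`, `pcurve t = p_c(t)`, `dP = ∂_pΘ_n`, `dT = ∂_tΘ_n`, and the stub
statements `LowerSubcurveBound`, `UpperSubcurveBound`).

* Idea `copivotal-census`: `LinearApproachWindow` (linear approach of the exchange rate to its curve
  value plus a window allowance measured by `Θ_n` itself) ⟹ BOTH one-sided sub-curve bounds (PROVED).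
* Idea `shape-density-exchange`: the z-stretch shape derivative `Shape n p t = n (Θ_{n,n,n+1} − Θ_{n,n,n})`,
  the three-term identity `ShapeDensityIdentity` on a FIXED sub-curve collar and `ShapeNegligible`
  on the `δ(η)`-strip ⟹ the crux.
-/

noncomputable section

namespace Summit.CriticalPhenomena.PercolationContinuityZ3.Cruxes.SubcritExchangeUniformity.Sketch

open MeasureTheory
open Literature.Probability.Percolation Literature.Probability.LatticeModels
open Summit.CriticalPhenomena.PercolationContinuityZ3.Theses.PercExchangeRateTransport

/-! ## §0 Local names (verbatim from `Lines/onesided.lean` §0–§1, whose olean is not built) -/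

/-- The law of the i.i.d. uniform labels on the bonds of `ℤ³`. -/
abbrev μ : Measure (Sym2 (Site 3) → ℝ) := labelMeasure (Site 3)

/-- `e` is a vertical (`z`-) bond. -/
def IsVert (e : Sym2 (Site 3)) : Prop := ∃ x : Site 3, e = s(x, x + Pi.single (2 : Fin 3) 1)

/-- The label-coupled anisotropic configuration at `(p,t)`. -/
def cfgPT (p t : ℝ) (U : Sym2 (Site 3) → ℝ) : Set (Sym2 (Site 3)) :=
  {e | e ∈ (zdGraph 3).edgeSet ∧ ((IsVert e ∧ U e ≤ t) ∨ (¬ IsVert e ∧ U e ≤ p))}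

/-- `Θ_n(p,t) = P(0 ↔ ∂Λ_n)`. -/
def ThetaBox (n : ℕ) (p t : ℝ) : ℝ := μ.real {U | cfgPT p t U ∈ siteToBoundary 3 n}

/-- `θ(p,t)`. -/
def thetaPerc (p t : ℝ) : ℝ := μ.real {U | cfgPT p t U ∈ percolatesAt (0 : Site 3)}

/-- `p_c(t)`. -/
def pcurve (t : ℝ) : ℝ := sInf ({p : ℝ | 0 ≤ p ∧ p ≤ 1 ∧ 0 < thetaPerc p t} ∪ {1})

/-- `∂_pΘ_n(p,t)`. -/
def dP (n : ℕ) (p t : ℝ) : ℝ := deriv (fun q => ThetaBox n q t) p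

/-- `∂_tΘ_n(p,t)`. -/
def dT (n : ℕ) (p t : ℝ) : ℝ := deriv (fun s => ThetaBox n p s) t

/-- The crux over the local names (`Iff.rfl`, as in `Lines/onesided.lean`). -/
theorem subcritExchangeUniformity_iff :
    SubcritExchangeUniformity ↔
      ∀ lo hi : ℝ, 0 < lo → lo < hi → hi < 1 → ∃ σ : ℝ → ℝ, ContinuousOn σ (Set.Icc lo hi) ∧
        ∀ η > (0 : ℝ), ∃ δ > (0 : ℝ), ∃ m : ℕ, ∀ n ≥ m, ∀ t ∈ Set.Icc lo hi, ∀ p : ℝ,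
          pcurve t - δ ≤ p → p ≤ pcurve t →
            |dT n p t - σ t * dP n p t| ≤ η * dP n p t :=
  Iff.rfl

/-- `Lines/onesided.lean`'s load-bearing stub statement (verbatim): `a_n(p,t) ≥ a_n(p_c t,t) − η`. -/
def LowerSubcurveBound : Prop :=
  ∀ lo hi : ℝ, 0 < lo → lo < hi → hi < 1 →
    ∀ η > (0 : ℝ), ∃ δ > (0 : ℝ), ∃ m : ℕ, ∀ n ≥ m, ∀ t ∈ Set.Icc lo hi, ∀ p : ℝ,
      pcurve t - δ ≤ p → p ≤ pcurve t →
        dT n (pcurve t) t * dP n p t - η * dP n p t * dP n (pcurve t) t ≤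
          dT n p t * dP n (pcurve t) t

/-- `Lines/onesided.lean`'s mirror stub statement (verbatim): `a_n(p,t) ≤ a_n(p_c t,t) + η`. -/
def UpperSubcurveBound : Prop :=
  ∀ lo hi : ℝ, 0 < lo → lo < hi → hi < 1 →
    ∀ η > (0 : ℝ), ∃ δ > (0 : ℝ), ∃ m : ℕ, ∀ n ≥ m, ∀ t ∈ Set.Icc lo hi, ∀ p : ℝ,
      pcurve t - δ ≤ p → p ≤ pcurve t →
        dT n p t * dP n (pcurve t) t ≤
          dT n (pcurve t) t * dP n p t + η * dP n p t * dP n (pcurve t) t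

/-! ## Idea 1 — co-pivotal census: the sharp constant is inherited from the curve by integration -/

/-- `C⁺` of idea `copivotal-census` — LINEAR APPROACH WITH A SELF-MEASURED WINDOW (cross-multiplied;
the only division is by `Θ_n(p_c t,t)`): on a fixed strip below the curve,
`|a_n(p_c(t),t) − a_n(p,t)| ≤ K (p_c(t) − p) + η (1 − Θ_n(p,t)/Θ_n(p_c(t),t))` for `n ≥ m(η)`.
The `K`-term is the linear approach of BOTH face branches `∂_t m_F/∂_p m_F` (and of their `1/(n ∂_p m_F)`
finite-size corrections) to the curve value — it also absorbs the face-selection switch, whose jump is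
`O(dist)`; the `η`-term is window FLATNESS at any rate, the window being located by `Θ_n` itself
(`Θ_n(p,t) ≥ (1−ε) Θ_n(p_c t,t)`), with no exponent and no correlation length. Differential handle:
`∂_p a_n = C_pt − a_n C_pp` (co-pivotal census). -/
def LinearApproachWindow : Prop :=
  ∀ lo hi : ℝ, 0 < lo → lo < hi → hi < 1 → ∃ K : ℝ, ∃ δ₀ > (0 : ℝ), ∀ η > (0 : ℝ), ∃ m : ℕ, ∀ n ≥ m,
    ∀ t ∈ Set.Icc lo hi, ∀ p : ℝ, pcurve t - δ₀ ≤ p → p ≤ pcurve t →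
      |dT n (pcurve t) t * dP n p t - dT n p t * dP n (pcurve t) t| ≤
        (K * (pcurve t - p) + η * (ThetaBox n (pcurve t) t - ThetaBox n p t) / ThetaBox n (pcurve t) t) *
          (dP n p t * dP n (pcurve t) t)

/-- FIRST LEMMA of idea `copivotal-census` (real analysis; `δ(η) := min δ₀ (η/(2(|K|+1)))`;
`ModelFacts` supplies `0 ≤ Θ_n` and `∂_pΘ_n ≥ 0`):
`LinearApproachWindow ⟹` both one-sided sub-curve bounds of `Lines/onesided.lean`
(hence `SubcritExchangeUniformity` via `SubcritExchangeUniformity_of_items` given K⁺ and positivity). -/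
def FirstLemma_copivotal : Prop :=
  LinearApproachWindow → ModelFacts → LowerSubcurveBound ∧ UpperSubcurveBound

/-! ## Idea 2 — shape–density exchange: `(∂_t − σ ∂_p)Θ_n` is a shape derivative in disguise -/

/-- The box `[-n,n]² × [-(n+k), n+k]` of `ℤ²×ℤ`, stretched by `k` layers in the `z`-direction
on each side (`stretchedBox n 0 = box 3 n`). -/
noncomputable def stretchedBox (n k : ℕ) : Finset (Site 3) :=
  Fintype.piFinset fun i => Finset.Icc (-((if i = 2 then n + k else n : ℕ) : ℤ)) ((if i = 2 then n + k else n : ℕ) : ℤ)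

/-- The arm event to the boundary of the stretched box (same shape as `siteToBoundary 3 n`). -/
def siteToStretchedBoundary (n k : ℕ) : Set (BondConfig (Site 3)) :=
  {ω | ∃ y ∈ innerBoundary (zdGraph 3) (stretchedBox n k), ω ∈ openConnIn (↑(stretchedBox n k)) 0 y}

/-- `Θ_{n,n,n+k}(p,t)`: one-arm probability in the z-stretched box. -/
noncomputable def ThetaStretch (n k : ℕ) (p t : ℝ) : ℝ :=
  μ.real {U | cfgPT p t U ∈ siteToStretchedBoundary n k}

/-- The z-stretch SHAPE DERIVATIVE `S_n(p,t) := n · (Θ_{n,n,n+1}(p,t) − Θ_{n,n,n}(p,t))` — a third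
Russo-type response next to `∂_pΘ_n`, `∂_tΘ_n` (nonpositive: a farther z-face is harder to reach). -/
noncomputable def Shape (n : ℕ) (p t : ℝ) : ℝ := n * (ThetaStretch n 1 p t - ThetaBox n p t)

/-- The closed lower `ρ`-collar of the arc `t ∈ [lo,hi]` (curve included). -/
def lowerCollar (lo hi ρ : ℝ) : Set (ℝ × ℝ) :=
  {x | x.2 ∈ Set.Icc lo hi ∧ pcurve x.2 - ρ ≤ x.1 ∧ x.1 ≤ pcurve x.2}

/-- `(F1)` THREE-TERM SHAPE–DENSITY IDENTITY on a FIXED closed sub-curve collar: there are a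
continuous field `σ(p,t)` (predicted: the slope field of the level sets of the in-plane inverse
correlation length `m_xy`) and a bounded field `κ(p,t)` (predicted: `(∂_t − σ∂_p) log (m_z/m_xy)`)
with `∂_tΘ_n = σ ∂_pΘ_n + κ S_n + o(∂_pΘ_n + |S_n|)` uniformly. Face selection is ABSORBED by the
shape term (`S_n ≈ −n m_z Θ_n` on the side where the z-face is cheapest, `≈ 0` on the other). -/
def ShapeDensityIdentity : Prop :=
  ∀ lo hi : ℝ, 0 < lo → lo < hi → hi < 1 → ∃ ρ > (0 : ℝ), ∃ σ κ : ℝ → ℝ → ℝ, ∃ B : ℝ,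
    ContinuousOn (fun x : ℝ × ℝ => σ x.1 x.2) (lowerCollar lo hi ρ) ∧
    (∀ x ∈ lowerCollar lo hi ρ, |κ x.1 x.2| ≤ B) ∧
    ∀ η > (0 : ℝ), ∃ m : ℕ, ∀ n ≥ m, ∀ t ∈ Set.Icc lo hi, ∀ p : ℝ, pcurve t - ρ ≤ p → p ≤ pcurve t →
      |dT n p t - σ p t * dP n p t - κ p t * Shape n p t| ≤ η * (dP n p t + |Shape n p t|)

/-- `(F2)` SHAPE NEGLIGIBILITY on the `δ(η)`-strip: the shape response is small against the
density response (window: pivotal proliferation `Σ Inf ≥ c Θ log(1/Θ)` + aspect-ratio stability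
`S_n = O(Θ_n)`; deep strip: `m_z / ∂_p m_z → 0` as `p ↑ p_c(t)`). -/
def ShapeNegligible : Prop :=
  ∀ lo hi : ℝ, 0 < lo → lo < hi → hi < 1 → ∀ η > (0 : ℝ), ∃ δ > (0 : ℝ), ∃ m : ℕ, ∀ n ≥ m,
    ∀ t ∈ Set.Icc lo hi, ∀ p : ℝ, pcurve t - δ ≤ p → p ≤ pcurve t → |Shape n p t| ≤ η * dP n p t

/-- FIRST LEMMA of idea `shape-density-exchange` (real analysis: `σ(t) := σ(p_c(t),t)`, uniform
continuity of `σ` on the compact collar, `p_c` continuous, `∂_pΘ_n ≥ 0`):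
`(F1) ∧ (F2) ⟹ SubcritExchangeUniformity`. -/
def FirstLemma_shape : Prop :=
  ShapeDensityIdentity → ShapeNegligible → ModelFacts → CriticalCurveRegular → SubcritExchangeUniformity

/-- In the continuum sibling `ℤ² × ℝ` (vertical lines cut at rate `λ`, bridges at rate `μ`, height
`h`) the `z`-dilation gives the EXACT Ward identity `λ ∂_λΘ + μ ∂_μΘ + h ∂_hΘ = 0`, so there `(F1)`
holds with no error and K± ⟺ `(F2)`. Recorded as a `Prop` schema over abstract `Θ : ℝ → ℝ → ℝ → ℝ`. -/
def ContinuumWardIdentity (Θ : ℝ → ℝ → ℝ → ℝ) : Prop :=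
  ∀ l u h : ℝ, 0 < l → 0 < u → 0 < h →
    l * deriv (fun x => Θ x u h) l + u * deriv (fun x => Θ l x h) u + h * deriv (fun x => Θ l u x) h = 0

/-- Euler: any `Θ` invariant under `(λ, μ, h) ↦ (λ/c, μ/c, c h)` and differentiable satisfies the
Ward identity (sketch target; the dilation invariance is exact for `ℤ² × ℝ`). -/
def FirstLemma_ward : Prop :=
  ∀ Θ : ℝ → ℝ → ℝ → ℝ, (∀ c l u h : ℝ, 0 < c → 0 < l → 0 < u → 0 < h → Θ (l / c) (u / c) (c * h) = Θ l u h) →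
    (∀ l u h : ℝ, 0 < l → 0 < u → 0 < h → DifferentiableAt ℝ (fun x : ℝ × ℝ × ℝ => Θ x.1 x.2.1 x.2.2) (l, u, h)) →
    ContinuumWardIdentity Θ

end Summit.CriticalPhenomena.PercolationContinuityZ3.Cruxes.SubcritExchangeUniformity.Sketch

end

noncomputable section

namespace Summit.CriticalPhenomena.PercolationContinuityZ3.Cruxes.SubcritExchangeUniformity.Sketch

open Summit.CriticalPhenomena.PercolationContinuityZ3.Theses.PercExchangeRateTransport

/-- The percolation-free core of the first lemma of `copivotal-census`: abstract `dT dP Θ pc`. -/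
theorem windowLipschitz_core {dT dP Θ : ℕ → ℝ → ℝ → ℝ} {pc : ℝ → ℝ} {lo hi : ℝ}
    (hW : ∃ K : ℝ, ∃ δ₀ > (0 : ℝ), ∀ η > (0 : ℝ), ∃ m : ℕ, ∀ n ≥ m,
      ∀ t ∈ Set.Icc lo hi, ∀ p : ℝ, pc t - δ₀ ≤ p → p ≤ pc t →
        |dT n (pc t) t * dP n p t - dT n p t * dP n (pc t) t| ≤
          (K * (pc t - p) + η * (Θ n (pc t) t - Θ n p t) / Θ n (pc t) t) * (dP n p t * dP n (pc t) t))
    (hnn : ∀ n p t, 0 ≤ Θ n p t)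
    (hdP : ∀ n p t, 0 ≤ dP n p t) :
    ∀ η > (0 : ℝ), ∃ δ > (0 : ℝ), ∃ m : ℕ, ∀ n ≥ m, ∀ t ∈ Set.Icc lo hi, ∀ p : ℝ,
      pc t - δ ≤ p → p ≤ pc t →
        |dT n (pc t) t * dP n p t - dT n p t * dP n (pc t) t| ≤ η * (dP n p t * dP n (pc t) t) := by
  obtain ⟨K, δ₀, hδ₀, hK⟩ := hW
  intro η hη
  obtain ⟨m, hm⟩ := hK (η / 2) (half_pos hη)
  have hpos : 0 < η / (2 * (|K| + 1)) := by positivity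
  refine ⟨min δ₀ (η / (2 * (|K| + 1))), lt_min hδ₀ hpos, m, fun n hn t ht p hp1 hp2 => ?_⟩
  have hp0 : pc t - δ₀ ≤ p := by linarith [min_le_left δ₀ (η / (2 * (|K| + 1)))]
  have h := hm n hn t ht p hp0 hp2
  have hdd : 0 ≤ dP n p t * dP n (pc t) t := mul_nonneg (hdP n p t) (hdP n (pc t) t)
  -- the coefficient is at most `η`
  have hgap : pc t - p ≤ η / (2 * (|K| + 1)) := by linarith [min_le_right δ₀ (η / (2 * (|K| + 1)))]
  have hK1 : K * (pc t - p) ≤ η / 2 := by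
    have h1 : K * (pc t - p) ≤ |K| * (pc t - p) :=
      mul_le_mul_of_nonneg_right (le_abs_self K) (by linarith)
    have h2 : |K| * (pc t - p) ≤ |K| * (η / (2 * (|K| + 1))) :=
      mul_le_mul_of_nonneg_left hgap (abs_nonneg K)
    have h3 : |K| * (η / (2 * (|K| + 1))) ≤ η / 2 := by
      rw [show |K| * (η / (2 * (|K| + 1))) = (η / 2) * (|K| / (|K| + 1)) by field_simp]
      have : |K| / (|K| + 1) ≤ 1 := div_le_one_of_le₀ (by linarith) (by positivity)
      calc (η / 2) * (|K| / (|K| + 1)) ≤ (η / 2) * 1 :=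
            mul_le_mul_of_nonneg_left this (half_pos hη).le
        _ = η / 2 := mul_one _
    linarith
  have hW1 : η / 2 * (Θ n (pc t) t - Θ n p t) / Θ n (pc t) t ≤ η / 2 := by
    rw [mul_div_assoc]
    have : (Θ n (pc t) t - Θ n p t) / Θ n (pc t) t ≤ 1 :=
      div_le_one_of_le₀ (by linarith [hnn n p t]) (hnn n (pc t) t)
    calc η / 2 * ((Θ n (pc t) t - Θ n p t) / Θ n (pc t) t) ≤ η / 2 * 1 :=
          mul_le_mul_of_nonneg_left this (half_pos hη).le
      _ = η / 2 := mul_one _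
  have hcoef : K * (pc t - p) + η / 2 * (Θ n (pc t) t - Θ n p t) / Θ n (pc t) t ≤ η := by linarith
  exact h.trans (mul_le_mul_of_nonneg_right hcoef hdd)

/-- **FIRST LEMMA of `copivotal-census`, PROVED**: `LinearApproachWindow → ModelFacts →
LowerSubcurveBound ∧ UpperSubcurveBound` (the two one-sided bounds are the two halves of the
absolute value delivered by `windowLipschitz_core`; `ModelFacts` gives monotonicity,
nonnegativity of `Θ_n` and, via `Monotone.deriv_nonneg`, `∂_pΘ_n ≥ 0`). -/
theorem firstLemma_copivotal_holds : FirstLemma_copivotal := by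
  intro hW hMF
  obtain ⟨-, -, h3, -, -, h6, -, -, -, -⟩ := hMF
  have hnn : ∀ n p t, 0 ≤ ThetaBox n p t := fun n p t => (h6 n p t).1
  have hdP : ∀ n p t, 0 ≤ dP n p t := fun n p t => Monotone.deriv_nonneg (h3 n t)
  constructor
  · intro lo hi hlo hlh hhi η hη
    obtain ⟨δ, hδ, m, hm⟩ :=
      windowLipschitz_core (hW lo hi hlo hlh hhi) hnn hdP η hη
    refine ⟨δ, hδ, m, fun n hn t ht p hp1 hp2 => ?_⟩
    have h := hm n hn t ht p hp1 hp2
    have h' := (abs_le.mp h).2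
    linarith
  · intro lo hi hlo hlh hhi η hη
    obtain ⟨δ, hδ, m, hm⟩ :=
      windowLipschitz_core (hW lo hi hlo hlh hhi) hnn hdP η hη
    refine ⟨δ, hδ, m, fun n hn t ht p hp1 hp2 => ?_⟩
    have h := hm n hn t ht p hp1 hp2
    have h' := (abs_le.mp h).1
    linarith

end Summit.CriticalPhenomena.PercolationContinuityZ3.Cruxes.SubcritExchangeUniformity.Sketch

end

noncomputable section

namespace Summit.CriticalPhenomena.PercolationContinuityZ3.Cruxes.SubcritExchangeUniformity.Sketch

open Summit.CriticalPhenomena.PercolationContinuityZ3.Theses.PercExchangeRateTransport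

/-- The lower collar is compact when the curve is continuous on `[lo,hi]`: it is the image of
`[lo,hi] × [0,ρ]` under `(t,s) ↦ (p_c t − s, t)`. -/
theorem isCompact_lowerCollar {lo hi ρ : ℝ} (hpc : ContinuousOn pcurve (Set.Icc lo hi)) :
    IsCompact (lowerCollar lo hi ρ) := by
  have hK : IsCompact (Set.Icc lo hi ×ˢ Set.Icc (0 : ℝ) ρ) := isCompact_Icc.prod isCompact_Icc
  have hf : ContinuousOn (fun y : ℝ × ℝ => ((pcurve y.1 - y.2, y.1) : ℝ × ℝ))
      (Set.Icc lo hi ×ˢ Set.Icc (0 : ℝ) ρ) := by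
    refine ContinuousOn.prodMk ?_ (continuous_fst.continuousOn)
    exact (hpc.comp continuous_fst.continuousOn fun y hy => hy.1).sub continuous_snd.continuousOn
  have himg : lowerCollar lo hi ρ =
      (fun y : ℝ × ℝ => ((pcurve y.1 - y.2, y.1) : ℝ × ℝ)) '' (Set.Icc lo hi ×ˢ Set.Icc (0 : ℝ) ρ) := by
    ext x
    simp only [lowerCollar, Set.mem_setOf_eq, Set.mem_image, Set.mem_prod, Set.mem_Icc, Prod.ext_iff]
    constructor
    · rintro ⟨ht, h1, h2⟩
      exact ⟨(x.2, pcurve x.2 - x.1), ⟨ht, by linarith, by linarith⟩, by ring, rfl⟩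
    · rintro ⟨y, ⟨hy1, hy2, hy3⟩, hx1, hx2⟩
      refine ⟨?_, ?_, ?_⟩
      · rw [← hx2]; exact hy1
      · rw [← hx1, ← hx2]; linarith
      · rw [← hx1, ← hx2]; linarith
  rw [himg]
  exact hK.image_of_continuousOn hf

/-- **FIRST LEMMA of `shape-density-exchange`, PROVED**:
`ShapeDensityIdentity → ShapeNegligible → ModelFacts → CriticalCurveRegular → SubcritExchangeUniformity`
(`σ(t) := σ(p_c(t),t)`; uniform continuity of `σ` on the compact collar; `|κ| ≤ B`; `∂_pΘ_n ≥ 0`). -/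
theorem firstLemma_shape_holds : FirstLemma_shape := by
  intro hF1 hF2 hMF hCC
  obtain ⟨-, -, h3, -, -, -, -, -, -, -⟩ := hMF
  have hdP : ∀ n p t, 0 ≤ dP n p t := fun n p t => Monotone.deriv_nonneg (h3 n t)
  obtain ⟨hpcI, -⟩ := hCC
  rw [subcritExchangeUniformity_iff]
  intro lo hi hlo hlh hhi
  obtain ⟨ρ, hρ, σ, κ, B, hσ, hκ, hid⟩ := hF1 lo hi hlo hlh hhi
  have hsub : Set.Icc lo hi ⊆ Set.Ioo (0 : ℝ) 1 := fun t ht => ⟨hlo.trans_le ht.1, ht.2.trans_lt hhi⟩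
  have hpc : ContinuousOn pcurve (Set.Icc lo hi) := hpcI.mono hsub
  -- σ along the curve is continuous
  have hγ : ContinuousOn (fun t : ℝ => ((pcurve t, t) : ℝ × ℝ)) (Set.Icc lo hi) :=
    hpc.prodMk continuousOn_id
  have hmaps : Set.MapsTo (fun t : ℝ => ((pcurve t, t) : ℝ × ℝ)) (Set.Icc lo hi) (lowerCollar lo hi ρ) :=
    fun t ht => ⟨ht, by simp only; linarith, le_rfl⟩
  refine ⟨fun t => σ (pcurve t) t, hσ.comp hγ hmaps, fun η hη => ?_⟩
  -- uniform continuity of σ on the compact collar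
  have hunif := (isCompact_lowerCollar (ρ := ρ) hpc).uniformContinuousOn_of_continuous hσ
  obtain ⟨δ₃, hδ₃, hδ₃'⟩ := Metric.uniformContinuousOn_iff.1 hunif (η / 4) (by linarith)
  -- (F1) at η/4, (F2) at η₂
  obtain ⟨m₁, hm₁⟩ := hid (η / 4) (by linarith)
  have hB : 0 ≤ B := by
    have h := hκ (pcurve lo, lo) ⟨⟨le_rfl, hlh.le⟩, by simp only; linarith, le_rfl⟩
    exact (abs_nonneg _).trans h
  set η₂ := min 1 (η / (4 * (B + 1))) with hη₂def
  have hη₂pos : 0 < η₂ := lt_min one_pos (by positivity)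
  have hη₂le1 : η₂ ≤ 1 := min_le_left _ _
  have hη₂B : B * η₂ ≤ η / 4 := by
    have h1 : B * η₂ ≤ B * (η / (4 * (B + 1))) := mul_le_mul_of_nonneg_left (min_le_right _ _) hB
    have h2 : B * (η / (4 * (B + 1))) = (η / 4) * (B / (B + 1)) := by field_simp
    have h3 : B / (B + 1) ≤ 1 := div_le_one_of_le₀ (by linarith) (by linarith)
    calc B * η₂ ≤ (η / 4) * (B / (B + 1)) := by rw [← h2]; exact h1
      _ ≤ (η / 4) * 1 := mul_le_mul_of_nonneg_left h3 (by linarith)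
      _ = η / 4 := mul_one _
  obtain ⟨δ₂, hδ₂, m₂, hm₂⟩ := hF2 lo hi hlo hlh hhi η₂ hη₂pos
  refine ⟨min ρ (min δ₂ (δ₃ / 2)), lt_min hρ (lt_min hδ₂ (by linarith)), max m₁ m₂,
    fun n hn t ht p hp1 hp2 => ?_⟩
  have hn₁ : m₁ ≤ n := le_trans (le_max_left _ _) hn
  have hn₂ : m₂ ≤ n := le_trans (le_max_right _ _) hn
  have hpρ : pcurve t - ρ ≤ p := by linarith [min_le_left ρ (min δ₂ (δ₃ / 2))]
  have hpδ₂ : pcurve t - δ₂ ≤ p := by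
    linarith [min_le_right ρ (min δ₂ (δ₃ / 2)), min_le_left δ₂ (δ₃ / 2)]
  have hpδ₃ : pcurve t - δ₃ / 2 ≤ p := by
    linarith [min_le_right ρ (min δ₂ (δ₃ / 2)), min_le_right δ₂ (δ₃ / 2)]
  have h1 := hm₁ n hn₁ t ht p hpρ hp2
  have h2 := hm₂ n hn₂ t ht p hpδ₂ hp2
  have hκB := hκ (p, t) ⟨ht, hpρ, hp2⟩
  -- |σ(p,t) − σ(p_c t, t)| < η/4
  have hmem1 : (p, t) ∈ lowerCollar lo hi ρ := ⟨ht, hpρ, hp2⟩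
  have hmem2 : (pcurve t, t) ∈ lowerCollar lo hi ρ := ⟨ht, by simp only; linarith, le_rfl⟩
  have hdist : dist (p, t) (pcurve t, t) < δ₃ := by
    rw [Prod.dist_eq, Real.dist_eq, Real.dist_eq, sub_self, abs_zero, max_eq_left (abs_nonneg _),
      abs_sub_comm, abs_of_nonneg (by linarith)]
    linarith
  have h3 : |σ p t - σ (pcurve t) t| < η / 4 := by
    have := hδ₃' (p, t) hmem1 (pcurve t, t) hmem2 hdist
    rwa [Real.dist_eq] at this
  -- abbreviations and the estimate
  set D := dP n p t with hDdef
  set T := dT n p t with hTdef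
  set S := Shape n p t with hSdef
  have hD : 0 ≤ D := hdP n p t
  have hS : |S| ≤ η₂ * D := h2
  have hS1 : |S| ≤ D := hS.trans (by nlinarith)
  have e : T - σ (pcurve t) t * D =
      (T - σ p t * D - κ p t * S) + κ p t * S + (σ p t - σ (pcurve t) t) * D := by ring
  calc |T - σ (pcurve t) t * D|
      = |(T - σ p t * D - κ p t * S) + κ p t * S + (σ p t - σ (pcurve t) t) * D| := by rw [e]
    _ ≤ |(T - σ p t * D - κ p t * S) + κ p t * S| + |(σ p t - σ (pcurve t) t) * D| := abs_add_le _ _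
    _ ≤ |T - σ p t * D - κ p t * S| + |κ p t * S| + |(σ p t - σ (pcurve t) t) * D| := by
        gcongr; exact abs_add_le _ _
    _ = |T - σ p t * D - κ p t * S| + |κ p t| * |S| + |σ p t - σ (pcurve t) t| * D := by
        rw [abs_mul, abs_mul, abs_of_nonneg hD]
    _ ≤ η / 4 * (D + |S|) + B * |S| + η / 4 * D := by
        have h3' := h3.le
        gcongr
    _ ≤ η / 4 * (D + D) + B * (η₂ * D) + η / 4 * D := by
        gcongr
    _ = (η / 4 + η / 4 + B * η₂ + η / 4) * D := by ring
    _ ≤ (η / 4 + η / 4 + η / 4 + η / 4) * D := by gcongr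
    _ = η * D := by ring

end Summit.CriticalPhenomena.PercolationContinuityZ3.Cruxes.SubcritExchangeUniformity.Sketch

end
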